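import Mathlib
import Literature.MathematicalPhysics.QuantumFieldTheory.Balaban1983to89.T4EtaRateDefectSite
import Literature.MathematicalPhysics.QuantumFieldTheory.Balaban1983to89.T4RateAlgebra
import Literature.MathematicalPhysics.QuantumFieldTheory.Balaban1983to89.T4GaugeActionRatePair
import Literature.MathematicalPhysics.QuantumFieldTheory.Balaban1983to89.T4Rate166StripDirect

/-!
# `Balaban1983to89.T4EtaRateSiteOfRatePair` — the typed NE2 SITE layer `T4EtaRate.EtaRateIneqSite` / `NE2PlusSite` on the
single-scale `U ≡ 1` instance of [B9]'s site carrier 𝔅, its dictionary with the unit-lattice rate pairs `T4RateAlgebra.RatePair`,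
and its FIRST NON-TOY INHABITANT: the (1.66)-layer entry kernels of `T4GaugeActionRatePair` (BY NAME)

Cell `pub-balaban`, units `b2b-balaban-pv25-g14` (v1 p188304 `f93857e2d675`; v1.1 p188614 = v1 with ONE docstring sentence
re-labelled — the HONEST FRAMING attribution below — and every declaration byte-identical) and `b2b-balaban-pv25-g16` (v1.2 =
the RETYPE `## v1.2` below: [B9]'s cube-size parameter `M` threaded through the carrier family as an index, plus the §4 READOUT
equivalences and a separating family — the referee's repair R1 of XREAD C-pv05g13-12, VACUITY-OF-TYPE V1); the η-rate lineage:
`T4EtaRate` p178744, `T4RateAlgebra` p178920, `T4EtaRateUnitWitness` p185409, `T4EtaRateDefect` p187761, `T4EtaRateDefectSite`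
p187690; T4-DAG node U1a = the NE2 background layer, record `t4/T4-EST-U1a.md`).  Self-row T4-U1a.S-NE2-SITE-RATEPAIR° =
items (K3a)+(K3b) of the gen-13 successor menu (v1.2: self-row T4-U1a.S-NE2-SITE-MINDEX°): the producers of
`T4EtaRateDefectSite` §2 reach the row's typed shapes `EtaRateIneqSite` / `NE2PlusSite` BY NAME but were, so far, fed only
by the one-point toy (`T4EtaRateDefectSite.pt9Geo`); meanwhile the prover seats' unit-lattice η-rate THEOREMS are stated
as `T4RateAlgebra.RatePair` (`T4GaugeActionRatePair.ratePair_kerFamily` for (1.66), `T4Rate166StripDirect.ratePair_kerFamily2`,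
and `T4Hk163RatePair.ratePair_kerHFamily` for (1.63) — the last one PENDING at the gate when this module was written, hence not
imported).  This module is the missing wire between the two.

## The object (§1)

[B9]'s site carrier is `𝔅 = ⋃_{j=0}^{k} Λ_j` (p. 397, tree header `B9.lean`: *"y, y′ ∈ 𝔅 = ⋃_{j=0}^k Λ_j. … if y ∈ Λ_j, then
Δ(y) = B^j(y)"*).  With NO large-field regions (the `U ≡ 1`, `A = 0` sub-theory: every Ω_j is the whole torus) all sites have
the top scale index `j = k`, `𝔅 = Λ_k` = the UNIT lattice `T₁^{(k)}` (`L^kη = 1`, `η = L^{−k}`).  `windowGeo d L M k Λ` is this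
single-scale carrier read on a finite window `Λ ⊂ ℤ^d` of the infinite unit lattice on which the rate pairs of `T4RateAlgebra`
live (sites `↥Λ`, `scale ≡ k`, `η = (L^k)⁻¹`, `dist y y′ = |y − y′|₁`, inert one-point argument / cut-off sorts; since v1.2 the
cube-size parameter `M` of [B9] (3.35) is an ARGUMENT — inert in the `U ≡ 1` model, carried only so that the guard `M₅ ≤ M` of the
packaged shapes means "for every `M ≥ M₅`"), over the one-point background carrier `T4EtaRateDefectSite.pt9Bg`
(`Cfg = {U ≡ 1}`, (3.35)–(3.38) trivially true).  The η-DIFFERENCE SITE KERNEL of a scale-indexed translation-invariant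
family `X : ℕ → ℤ^d → ℝ` between the runs `k + 1` (fine) and `k` (coarse), paired by the identity
on unit-lattice sites (King's convention, [King1986] p. 664), is `stepKernel X L M k Λ : (U, y, y′) ↦
X_{k+1}(y − y′) − X_k(y − y′)` (= `T4RateAlgebra.step X k (y − y′)`); the paired-instance family `windowInstance` indexes it by
`(k, Λ, M)`, ALL `M ≥ 1`.

## What is here (0 sorry; every declaration [folklore] = elementary bookkeeping, or a shape-location [cite])

* §1 the carrier: `windowGeo`, `windowGeo_len` (`L^jη = 1`), `rateFactor_windowGeo` (King's factor `(η/L^jη)^γ` IS the clean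
  geometric rate `(L^{−γ})^k` at unit sites — `T4EtaRate.rateFactor_unit` + `eta_rpow_eq_theta_pow`), `stepKernel`,
  `windowPairing` (n = 1 extra scale, `η′L = η`), `windowInstance`.
* §2 THE DICTIONARY (pointwise currency): `etaRateIneqSite_window_iff` — on the window carrier the (3.48)-type weights
  `(L^jη)^{−p}(L^{j′}η)^{−d′}` are `1` and the max-rate-factor is `θ^k`, so `EtaRateIneqSite d′ p (stepKernel X L M k Λ) C δ γ U` IS
  `∀ y y′ ∈ Λ, |X_{k+1}(y−y′) − X_k(y−y′)| ≤ C e^{−δ|y−y′|₁} θ^k` with `θ = L^{−γ}`; `forall_window_iff_unitStepIneq` — demanded for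
  ALL windows (and all k) it is EQUIVALENT to the geometry-free shape `T4RateAlgebra.UnitStepIneq X C δ θ` (two-point windows
  suffice); hence `etaRateIneqSite_of_ratePair`: a rate pair `RatePair X C δ C′ θ` with `θ = L^{−γ}` gives `EtaRateIneqSite d′ p …
  C′ δ γ U` for EVERY exponent pair `(d′, p)`, uniformly in `(k, Λ, M)`; `etaRateIneqSite_mono_const` (constants may be enlarged).
* §3 THE SAME in the block-majorant currency of `B11SectG.HasMaj` (the input format of `T4EtaRateDefectSite`'s producers):
  `convOp f Λ` = the Λ-compressed convolution operator `(μ ↦ Σ_{y′∈Λ} f(y−y′)μ(y′))`, `entry_convOp` (its matrix entry is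
  `f(y−y′)`), `hasMaj_convOp_iff` (between the (3.48)-normalised norms `srcNorm d′` / `obsNorm id p` of `T4EtaRateDefectSite` a
  block majorant `K` of `convOp f Λ` IS `|f(y−y′)| ≤ K(y,y′)`), `hasMaj_convOp_step_of_ratePair` (a rate pair gives EXACTLY the
  hypothesis of `T4EtaRateDefectSite.etaRateIneqSite_of_hasMaj`: majorant `C′·e^{−δd(y,y′)}·rateWeight γ (y′)`),
  `defectKernel_convOp` (K2's `defectKernel id (U ↦ convOp (step X k) Λ)` IS `stepKernel X L M k Λ`) and
  `etaRateIneqSite_of_ratePair'` — the conclusion of §2 re-obtained THROUGH K2's producer: the two currencies agree.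
* §4 packaging under the row's quantifier blocks: `NE2ZeroSite` (the site-layer twin of `T4EtaRate.NE2ZeroOperator` /
  `T4EtaRateUnitWitness.NE2ZeroUnit`: the inequality at the trivial background only), `ne2ZeroSite_of_ne2PlusSite` (bookkeeping
  twin of `T4EtaRate.ne2Zero_of_ne2Plus`), and over the window family: `ne2PlusSite_of_ratePair`, `ne2ZeroSite_of_ratePair` — a
  rate pair with `δ > 0`, `θ = L^{−γ}`, `γ > 0` INHABITS `T4EtaRate.NE2PlusSite d′ p c35 windowInstance (stepKernels X)` and
  `NE2ZeroSite`, constants `(M₅, δ, a₀, C, γ) = (1, δ, 1, max C′ 1, γ)`; and (v1.2) THE READOUT — the packaged types are NOT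
  vacuous and NOT more than NE2⁰-at-`U ≡ 1`: `ne2PlusSite_of_unitStepIneq`, `exists_unitStepIneq_of_ne2ZeroSite` (a proof of
  `NE2ZeroSite` on the window family RETURNS `UnitStepIneq X C δ (L^{−γ})` with `C, δ, γ > 0`; index `M := max M₅ 1`),
  the EQUIVALENCES `ne2ZeroSite_window_iff` / `ne2PlusSite_window_iff` (both packaged types ⟺ `∃ C δ γ > 0, UnitStepIneq X C δ
  (L^{−γ})`), and the SEPARATING FAMILY `not_ne2ZeroSite_pow_two` / `not_ne2PlusSite_pow_two` (for the rate-less `X_k ≡ 2^k`,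
  `L = 2`, both types are FALSE).
* §5 THE FIRST NON-TOY INHABITANT, BY NAME: from `T4GaugeActionRatePair.ratePair_kerFamily` (seat t4-ne2-p2; the real parts
  `Re K^{(L^k)}_{ab}(x)` of the unit-lattice position-space kernels of the (1.66) entry symbol, `μ ≠ ν`):
  `etaRateIneqSite_kerFamily166` (every `L ≥ 1`, `k`, window, `(d′, p)`; `γ = 1`, `δ = δ₁₆₆(d)`, `C = 8·CWs(d+1)`),
  `unitStepIneq_kerFamily166_iff` (consistency with that module's own T4 reading), `ne2PlusSite_kerFamily166` and
  `ne2ZeroSite_kerFamily166` (every `L ≥ 1`; `γ = 1 > 0`; the rate `θ = L⁻¹` is `< 1` iff `L ≥ 2`); at KING'S FULL EXPONENT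
  `γ = 2` from `T4Rate166StripDirect.ratePair_kerFamily2` (same seat, `θ = L⁻²`, `δ = κ₁₆₆(d+1)/(d+1)`, `C = 8·C166(d+1)`):
  `etaRateIneqSite_kerFamily166_king`, `ne2PlusSite_kerFamily166_king`; and the smoke test on `T4RateAlgebra.Witness`.

## v1.2 (unit `b2b-balaban-pv25-g16`) — XREAD C-pv05g13-12, VACUITY-OF-TYPE (V1), answered by the referee's repair R1

THE OBJECTION (reader pv05 gen 13, on v1.1 of this module and of `T4EtaRateSiteTorus`; kernel-checked probes V1–V4 in the
reader's appendix): every instance of the v1.1 families had `gf.M = 1` (`windowGeo … M := 1`), while `T4EtaRate.NE2PlusSite` and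
`NE2ZeroSite` guard each index by `M₅ ≤ (pi i).gf.M` with `M₅` EXISTENTIAL; hence `M₅ := 2` voided the guard at every index and
the anonymous witness `⟨2, 1, 1, 1, 1, two_pos, one_pos, one_pos, one_pos, one_pos, fun i hM => by norm_num [windowInstance] at hM⟩`
inhabited `NE2PlusSite d′ p c35 (windowInstance d hL) Kd` for EVERY kernel family `Kd` — the §4–§5 inhabitation theorems were
true, but their TYPE carried no content (the content-carrying statements were the guard-free, constant-explicit §2/§5 ones).
THE REPAIR (R1, this revision): the carrier takes [B9]'s cube-size parameter as an argument, `windowGeo d L M k Λ` (`M := M`);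
the index `WindowIndex` gains the fields `M : ℝ`, `one_le : 1 ≤ M`; `windowInstance` / `stepKernels` range over ALL `M ≥ 1`.  The
guard `M₅ ≤ M` now reads: for every index with `M ≥ M₅` — a non-empty, co-final condition, i.e. the threshold quantifier
(for M ≥ M₁) of [B9] Thm 3.1's printed frame (p. 397), under whose assumptions Thm 3.2 / Thm 3.14 are stated, read literally
as the tree types it (binder template `∃ M₅ …, ∀ i, M₅ ≤ (geo i).M → …` of `B9.Thm314Printed`; attribution corrected in
v1.2.1, see below).  Every §1–§3 / §5 declaration keeps its name, statement shape and proof and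
gains the inert binder `(M : ℝ)` (placed right after `hL` / `L`); the §4 producers `ne2PlusSite_of_ratePair` /
`ne2ZeroSite_of_ratePair` and the §5 family theorems keep their statements verbatim (the family they speak of is now larger).
NEW, kernel-checked (§4): the readout `exists_unitStepIneq_of_ne2ZeroSite`, the producer `ne2PlusSite_of_unitStepIneq`, the
equivalences `ne2ZeroSite_window_iff` / `ne2PlusSite_window_iff`, the separating family `not_ne2ZeroSite_pow_two` /
`not_ne2PlusSite_pow_two`.  V1's witnesses (V3/V4 for this module) NO LONGER ELABORATE against v1.2: `norm_num [windowInstance]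
at hM` leaves `hM : 2 ≤ i.M` and the goal open (must-fail probe archived by the cell next to the proposal, not in the tree).

## v1.2.1 (unit `b2b-balaban-pv25-g17`) — DOCSTRING-ONLY: XREAD C-pv12g18-1, DOCFIX D1 (attribution of the threshold quantifier)

The v1.2 paragraph above (as landed in p190072) set a phrase of the form *there is M₅ such that for M ≥ M₅* in quotation
italics under the name of [B9] Thm 3.14.  That was a misattribution, corrected here and in the `M` field docstring of
`WindowIndex`: print Thm 3.14 (pp. 426–427) carries no such words and no `M₅` — it states that the difference operators
satisfy the inequalities characteristic for operators of the considered type with the additional factor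
exp(−δ₀d(y, y′, Ω)) (tree `B9.Thm314Printed`, verbatim frame in its docstring).  The threshold quantifier — positive
constants M₁, δ₀, a₀, B₀ depending on d and L only, then for M ≥ M₁ — is the printed frame of [B9] Thm 3.1 (p. 397; tree
`B9.Thm31Printed`, verbatim frame in its docstring), under whose assumptions Thm 3.2 and Thm 3.14 are stated; the tree types
it for Thm 3.14 as the binder template `∃ M₅ δ₀ a₀ B₀, … ∀ i, M₅ ≤ (geo i).M → …` of `B9.Thm314Printed`, and THAT template
is what the guard `M₅ ≤ (pi i).gf.M` of `T4EtaRate.NE2PlusSite` / `NE2ZeroSite` copies.  No statement, proof, name or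
import changed (docstring text only); nothing printed is quoted anew.

## HONEST SCOPE / what is NOT claimed

(i) `U ≡ 1`, single scale, linear layer, finite windows of the infinite unit lattice `ℤ^d` (periodisation to the torus `T₁` is
NOT done here — the torus kernels are the `ksum` of `B5Kernel166Decay`); the multi-scale carrier 𝔅 with `j < k` only arises
with large-field regions and is not instantiated.  (ii) As in `T4EtaRateUnitWitness` (ii): in §4–§5 the background quantifier of
`NE2PlusSite` ranges over `{U ≡ 1}` and (3.35) is trivial there — this is NE2⁰ CONTENT inside NE2⁺'s TYPE; the
background-dependent estimate NE2⁺ (`T4EtaRate` §3, NOT PRINTED; census (N3) of `T4EtaRateDefect`) is neither printed nor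
claimed.  Rate, decay and the uniformity in `(k, Λ, M)` are genuine and come from the cited prover module; by the v1.2
equivalences the packaged types on the window family say EXACTLY `∃ C δ γ > 0, UnitStepIneq X C δ (L^{−γ})` — no more, no less.
(iii) Nothing printed
is used as a hypothesis; the [cite] tags locate SHAPES: [B9] (3.41) p. 397 (site scale convention) and Thm 3.2 (3.48) p. 398
(normalisation), both re-used from the cross-read tree header `B9.lean`; [King1986] p. 664 (identity pairing of unit-lattice
sites across runs) and Lemma 4.5 (4.38) p. 674 (*"|C^{(k)}(x, y) − C^{(k+n)}(x, y)| ≤ CL^{−k}e^{−δ₀|x−y|}"*, the printed `A = 0`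
SIBLING of the shape, as carried by `T4RateAlgebra.UnitStepIneq`; its single-scale assembly is now in the tree as
`King1986.SingleScaleRate`, seat t4-lit2 — not used here); [Balaban1984PropagatorsI] (1.66) p. 29 (the object of §5, through
`T4GaugeActionRatePair`).  NOT NE2⁺, NOT NE1′, NOT continuum, NOT infinite-volume Yang–Mills, NOT a mass gap, NOT Clay; rung
(B)+1 finite-`T⁴` scoping; NOT summit progress.  (iv) (v1.2) The cube-size index `M` is INERT: it enters no kernel, norm or
constant of this module — only the guard of the packaged shapes; [B9]'s `M`-dependence ((3.35) `Mα₀ ≤ a₀`, `M ≥ M₅`) is thus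
represented as a QUANTIFIER, faithfully, but carries no analytic content at `U ≡ 1` (the side condition `Mα₀ ≤ a₀` is met by
`α₀ := a₀/M`, as in `ne2ZeroSite_of_ne2PlusSite`).

HONEST FRAMING (cell framing — a PARAPHRASE of `HOME/t4/T4-DAG.md` PAGE 1, not a quotation of it; wording inherited from the
headers of `T4RateAlgebra` p178920 / `T4GaugeActionRatePair` p184845; re-labelled in v1.1 after XREADs C-pv05g13-8 / C-pv12g16-1, D1): T4 is
OPEN. The deliverables are: located quotations, a uniformity census, typed hypothesis shapes, estimate sketches with every
non-printed step flagged, and kernel-checked bookkeeping lemmas. None of this is summit progress.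

ABSOLUTE RULE (cell, verbatim): No internally-minted statement may enter as a cited fact. Every hypothesis is either
kernel-proved in this package or a verbatim quotation of a PUBLISHED theorem with page reference. The manuscript(s) under
audit are NOT citable for their own disputed steps — they are the thing under adjudication; programme-internal
(2001/route/tribunal) claims are never citable.

Imports BY NAME, nothing modified: `T4EtaRateDefectSite` (own lineage: `entry`, `srcNorm`, `obsNorm`, `hasMaj_site_iff`,
`etaRateIneqSite_of_hasMaj`, `defectKernel`, `pt9Bg`, `len_nonneg`), `T4RateAlgebra` (own lineage: `RatePair`, `step`,
`UnitStepIneq`, `unitStepIneq_iff`, `Witness.ratePair`), `T4GaugeActionRatePair` (seat t4-ne2-p2, p184845: `kerFamily`,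
`ratePair_kerFamily`, `delta166_pos`), `T4Rate166StripDirect` (same seat: `ratePair_kerFamily2`, `C166`;
`B5Symbol166Strip.kappa166_pos` of seat b05).
-/

namespace Literature.MathematicalPhysics.QuantumFieldTheory.Balaban1983to89.T4EtaRateSiteOfRatePair

open B11SectG (HasMaj)
open B12Sec2to5 (l1 l1_nonneg)
open T4EtaRate (rateFactor rateFactor_unit eta_rpow_eq_theta_pow rateFactor_nonneg EtaRateIneqSite NE2PlusSite
  PairedInstance EtaPairing)
open T4EtaRateDefect (rateWeight rateWeight_toB6)
open T4EtaRateDefectSite (entry entry_apply srcNorm obsNorm hasMaj_site_iff etaRateIneqSite_of_hasMaj defectKernel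
  pt9Bg len_nonneg)
open T4RateAlgebra (RatePair step step_apply UnitStepIneq unitStepIneq_iff)
open T4GaugeActionRateStrip (CWs)
open T4GaugeActionRatePair (kerFamily ratePair_kerFamily delta166 delta166_pos)
open B5Symbol166Strip (kappa166 kappa166_pos)
open T4Rate166StripDirect (ratePair_kerFamily2 C166)

noncomputable section

variable {d : ℕ}

/-! ## §1 The single-scale `U ≡ 1` instance of [B9]'s site carrier on a window of the unit lattice -/

/-- THE WINDOW CARRIER: [B9]'s 𝔅 with no large-field regions (`𝔅 = Λ_k`, every site of scale index `k`, `L^kη = 1`,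
`η = L^{−k}`) read on a finite window `Λ ⊂ ℤ^d` of the unit lattice: sites `↥Λ`, `dist y y′ = |y − y′|₁`, inert one-point
argument / cut-off sorts with zero sizes, [B9]'s cube-size parameter `M` as an ARGUMENT (v1.2 — it was the constant `1` in
v1/v1.1; inert here: it enters only the guard `M₅ ≤ M` of the packaged shapes); `reducible` so that the `Fintype` / `DecidableEq` instances of `↥Λ` are
found on its `Site`. [cite: Balaban1985BackgroundPropagators, (3.41) p.397 (site scale convention)] -/
@[reducible] def windowGeo (d : ℕ) (L M : ℝ) (k : ℕ) (Λ : Finset (Fin d → ℤ)) : B9.Geometry where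
  Site := ↥Λ
  scale := fun _ => k
  dist := fun y y' => l1 (y.1 - y'.1)
  k := k
  eta := (L ^ k)⁻¹
  L := L
  M := M
  Loc := Unit
  suppIn := fun _ _ => True
  suppInT := fun _ _ => True
  supNorm := fun _ => 0
  l2Norm := fun _ => 0
  wNorm := fun _ _ => 0
  holder := fun _ _ => 0
  Cut := Unit
  cutIn := fun _ _ => True
  cutInT := fun _ _ => True
  cutH := fun _ _ => 0
  cutSup := fun _ => 0
  suppInT_of_suppIn := fun _ _ h => h
  cutInT_of_cutIn := fun _ _ h => h

section Carrier

variable (L M : ℝ) (k : ℕ) (Λ : Finset (Fin d → ℤ))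

/-- The distance of the window carrier is `|y − y′|₁`. [folklore] -/
@[simp] theorem windowGeo_dist (y y' : (windowGeo d L M k Λ).Site) :
    (windowGeo d L M k Λ).dist y y' = l1 (y.1 - y'.1) := rfl

/-- The distance of the window carrier is nonnegative. [folklore] -/
theorem windowGeo_dist_nonneg (y y' : (windowGeo d L M k Λ).Site) : 0 ≤ (windowGeo d L M k Λ).dist y y' :=
  l1_nonneg _

/-- Every site of the window carrier has physical size `L^kη = 1` (`L ≠ 0`). [folklore] -/
@[simp] theorem windowGeo_len {L : ℝ} (hL : L ≠ 0) (M : ℝ) (k : ℕ) (Λ : Finset (Fin d → ℤ)) (y : (windowGeo d L M k Λ).Site) :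
    (windowGeo d L M k Λ).len y = 1 := by
  show L ^ k * (L ^ k)⁻¹ = 1
  exact mul_inv_cancel₀ (pow_ne_zero _ hL)

/-- The lattice spacing `η = L^{−k}` of the window carrier is positive (`L > 0`). [folklore] -/
theorem windowGeo_eta_pos {L : ℝ} (hL : 0 < L) (M : ℝ) (k : ℕ) (Λ : Finset (Fin d → ℤ)) : 0 < (windowGeo d L M k Λ).eta :=
  inv_pos.mpr (pow_pos hL k)

/-- KING'S RATE FACTOR IS THE CLEAN GEOMETRIC RATE at unit sites: `(η/L^jη)^γ = η^γ = (L^{−γ})^k` on the window carrier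
(`T4EtaRate.rateFactor_unit` + `eta_rpow_eq_theta_pow`). [cite: King1986, Prop. 3.9 (3.73) p.665 and Lemma 4.5 (4.38) p.674 (rate factor, shape)] -/
theorem rateFactor_windowGeo {L : ℝ} (hL : 0 < L) (M : ℝ) (k : ℕ) (Λ : Finset (Fin d → ℤ)) (γ : ℝ)
    (y : (windowGeo d L M k Λ).Site) : rateFactor (windowGeo d L M k Λ) γ y = (L ^ (-γ)) ^ k := by
  rw [rateFactor_unit γ (windowGeo_len hL.ne' M k Λ y)]
  exact eta_rpow_eq_theta_pow (g := windowGeo d L M k Λ) rfl hL γ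

/-- `(L^{−γ})^k = (L^k)^{−γ}` (`L ≥ 0`): the clean rate as a function of the scale. [folklore] -/
theorem rpow_neg_pow_comm {L : ℝ} (hL : 0 ≤ L) (γ : ℝ) (k : ℕ) : (L ^ (-γ)) ^ k = (L ^ k) ^ (-γ) := by
  rw [← Real.rpow_natCast, ← Real.rpow_mul hL, mul_comm, Real.rpow_mul hL, Real.rpow_natCast]

/-- On the [B6]-view of the window carrier the η-rate weight of `T4EtaRateDefect` is the clean rate `(L^{−γ})^k`. [folklore] -/
theorem rateWeight_windowGeo {L : ℝ} (hL : 0 < L) (M : ℝ) (k : ℕ) (Λ : Finset (Fin d → ℤ)) (R : ℝ) (H : Prop) (γ : ℝ)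
    (y : (windowGeo d L M k Λ).Site) :
    rateWeight (B9Thm34Ext.toB6 (windowGeo d L M k Λ) R H) γ y = (L ^ (-γ)) ^ k := by
  rw [rateWeight_toB6 (windowGeo d L M k Λ) R H (windowGeo_eta_pos hL M k Λ).ne' hL, rateFactor_windowGeo hL]

end Carrier

/-- THE η-DIFFERENCE SITE KERNEL of a scale-indexed translation-invariant unit-lattice family `X` between the runs `k + 1` and
`k`, on the window carrier over the one-point backgrounds: `(U, y, y′) ↦ X_{k+1}(y − y′) − X_k(y − y′)`
(= `T4RateAlgebra.step X k (y − y′)`; identity pairing of unit-lattice sites across runs). [cite: King1986, p.664 (identity pairing convention before Prop. 3.8) and Lemma 4.5 (4.38) p.674 (shape)] -/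
def stepKernel (X : ℕ → (Fin d → ℤ) → ℝ) (L M : ℝ) (k : ℕ) (Λ : Finset (Fin d → ℤ)) :
    B9.SiteKernel (windowGeo d L M k Λ) pt9Bg :=
  ⟨fun _ y y' => step X k (y.1 - y'.1)⟩

/-- Unfolding of `stepKernel`. [folklore] -/
@[simp] theorem stepKernel_ker (X : ℕ → (Fin d → ℤ) → ℝ) (L M : ℝ) (k : ℕ) (Λ : Finset (Fin d → ℤ)) (U : pt9Bg.Cfg)
    (y y' : (windowGeo d L M k Λ).Site) :
    (stepKernel X L M k Λ).ker U y y' = X (k + 1) (y.1 - y'.1) - X k (y.1 - y'.1) := rfl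

/-- THE IDENTITY η-PAIRING of the runs `k` (coarse, `η = L^{−k}`) and `k + 1` (fine, `η′ = L^{−(k+1)}`) on the same window:
`n = 1` extra scale, `η′L = η`, sites / arguments / backgrounds transported identically. [cite: King1986, p.664 (convention before Prop. 3.8)] -/
def windowPairing {L : ℝ} (hL : L ≠ 0) (M : ℝ) (k : ℕ) (Λ : Finset (Fin d → ℤ)) :
    EtaPairing (windowGeo d L M k Λ) (windowGeo d L M (k + 1) Λ) pt9Bg pt9Bg where
  n := 1
  k_eq := rfl
  L_eq := rfl
  M_eq := rfl
  eta_eq := by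
    show (L ^ (k + 1))⁻¹ * L ^ 1 = (L ^ k)⁻¹
    rw [pow_one, pow_succ, mul_inv, mul_assoc, inv_mul_cancel₀ hL, mul_one]
  ι := fun y => y
  scale_ι := fun _ => rfl
  dist_ι := fun _ _ => rfl
  τ := fun lam => lam
  suppIn_τ := fun _ _ h => h
  supNorm_τ := fun _ => le_rfl
  avg := fun U => U
  avg_one := rfl

/-- THE INDEX of the window family: the coarse run's number of scales `k`, the window `Λ` and (v1.2) the cube-size parameter
`M ≥ 1`. [folklore] -/
structure WindowIndex (d : ℕ) where
  /-- number of scales of the coarse run (`η = L^{−k}`) -/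
  k : ℕ
  /-- the finite window of the unit lattice -/
  Λ : Finset (Fin d → ℤ)
  /-- [B9]'s cube-size parameter `M` of (3.35) (v1.2; inert at `U ≡ 1`, carried so that the guard `M₅ ≤ M` of the packaged
  shapes reads: for every index with `M ≥ M₅` — the threshold frame (for M ≥ M₁) of [B9] Thm 3.1, p. 397, in the binder
  template by which the tree's `B9.Thm314Printed` types it; v1.2.1 attribution) -/
  M : ℝ
  /-- `M ≥ 1` -/
  one_le : 1 ≤ M

/-- THE PAIRED-INSTANCE FAMILY of window carriers (runs `k`, `k + 1`; all windows; ALL cube sizes `M ≥ 1` (v1.2); one-point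
backgrounds; identity pairing). [folklore] -/
def windowInstance (d : ℕ) {L : ℝ} (hL : L ≠ 0) (i : WindowIndex d) : PairedInstance where
  gc := windowGeo d L i.M i.k i.Λ
  gf := windowGeo d L i.M (i.k + 1) i.Λ
  Bc := pt9Bg
  Bf := pt9Bg
  pair := windowPairing hL i.M i.k i.Λ

/-- The window family's η-difference kernels of a unit-lattice family `X`. [folklore] -/
def stepKernels (X : ℕ → (Fin d → ℤ) → ℝ) {L : ℝ} (hL : L ≠ 0) :
    ∀ i : WindowIndex d, B9.SiteKernel (windowInstance d hL i).gc (windowInstance d hL i).Bf :=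
  fun i => stepKernel X L i.M i.k i.Λ

/-! ## §2 The dictionary, pointwise currency: `EtaRateIneqSite` on windows ⟺ `UnitStepIneq`; rate pairs produce it -/

section Pointwise

variable {X : ℕ → (Fin d → ℤ) → ℝ}

/-- Constants of the site-kernel inequality may be ENLARGED (all other factors are nonnegative; `L, η ≥ 0`). [folklore] -/
theorem etaRateIneqSite_mono_const {g : B9.Geometry} {B : B9.Backgrounds} (hL : 0 ≤ g.L) (hη : 0 ≤ g.eta) {d' : ℕ}
    {p C C₁ δ γ : ℝ} {Kd : B9.SiteKernel g B} {U : B.Cfg} (hC : C ≤ C₁) (h : EtaRateIneqSite d' p Kd C δ γ U) :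
    EtaRateIneqSite d' p Kd C₁ δ γ U := by
  intro y y'
  have hrest : 0 ≤ g.len y ^ (-p) * g.len y' ^ (-(d' : ℝ)) * Real.exp (-(δ * g.dist y y')) *
      max (rateFactor g γ y) (rateFactor g γ y') :=
    mul_nonneg (mul_nonneg (mul_nonneg (Real.rpow_nonneg (len_nonneg g hL hη y) _)
      (Real.rpow_nonneg (len_nonneg g hL hη y') _)) (Real.exp_pos _).le)
      (le_max_of_le_left (rateFactor_nonneg hη hL γ y))
  calc |Kd.ker U y y'|
      ≤ C * g.len y ^ (-p) * g.len y' ^ (-(d' : ℝ)) * Real.exp (-(δ * g.dist y y')) *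
          max (rateFactor g γ y) (rateFactor g γ y') := h y y'
    _ = C * (g.len y ^ (-p) * g.len y' ^ (-(d' : ℝ)) * Real.exp (-(δ * g.dist y y')) *
          max (rateFactor g γ y) (rateFactor g γ y')) := by ring
    _ ≤ C₁ * (g.len y ^ (-p) * g.len y' ^ (-(d' : ℝ)) * Real.exp (-(δ * g.dist y y')) *
          max (rateFactor g γ y) (rateFactor g γ y')) := mul_le_mul_of_nonneg_right hC hrest
    _ = C₁ * g.len y ^ (-p) * g.len y' ^ (-(d' : ℝ)) * Real.exp (-(δ * g.dist y y')) *
          max (rateFactor g γ y) (rateFactor g γ y') := by ring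

/-- **THE DICTIONARY, one window.**  On the window carrier the (3.48) weights are `1` and the max-rate-factor is `(L^{−γ})^k`:
`EtaRateIneqSite d′ p (stepKernel X L M k Λ) C δ γ U` IS `∀ y y′ ∈ Λ, |X_{k+1}(y−y′) − X_k(y−y′)| ≤ C·e^{−δ|y−y′|₁}·(L^{−γ})^k`.
[cite: Balaban1985BackgroundPropagators, Thm 3.2 (3.48) p.398 (normalisation, shape); King1986, Lemma 4.5 (4.38) p.674 (A = 0 sibling)] -/
theorem etaRateIneqSite_window_iff {L : ℝ} (hL : 0 < L) (M : ℝ) (k : ℕ) (Λ : Finset (Fin d → ℤ)) (d' : ℕ) (p C δ γ : ℝ)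
    (U : pt9Bg.Cfg) :
    EtaRateIneqSite d' p (stepKernel X L M k Λ) C δ γ U ↔
      ∀ y y' : ↥Λ, |X (k + 1) (y.1 - y'.1) - X k (y.1 - y'.1)| ≤
        C * Real.exp (-(δ * l1 (y.1 - y'.1))) * (L ^ (-γ)) ^ k := by
  have key : ∀ y y' : (windowGeo d L M k Λ).Site,
      C * (windowGeo d L M k Λ).len y ^ (-p) * (windowGeo d L M k Λ).len y' ^ (-(d' : ℝ)) *
          Real.exp (-(δ * (windowGeo d L M k Λ).dist y y')) *
          max (rateFactor (windowGeo d L M k Λ) γ y) (rateFactor (windowGeo d L M k Λ) γ y') =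
        C * Real.exp (-(δ * l1 (y.1 - y'.1))) * (L ^ (-γ)) ^ k := by
    intro y y'
    rw [windowGeo_len hL.ne', windowGeo_len hL.ne', rateFactor_windowGeo hL M k Λ γ y, rateFactor_windowGeo hL M k Λ γ y',
      Real.one_rpow, Real.one_rpow, max_self, windowGeo_dist]
    ring
  constructor
  · intro h y y'
    have H := h y y'
    rw [key, stepKernel_ker] at H
    exact H
  · intro h y y'
    rw [key, stepKernel_ker]
    exact h y y'

/-- **THE DICTIONARY, all windows: the typed site layer at `U ≡ 1` IS the geometry-free unit-lattice shape.**  Demanded on every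
window `Λ` and every `k`, `EtaRateIneqSite d′ p (stepKernel X L M k Λ) C δ γ` is EQUIVALENT to `T4RateAlgebra.UnitStepIneq X C δ θ`
with `θ = L^{−γ}` (two-point windows suffice for the converse). [folklore] -/
theorem forall_window_iff_unitStepIneq {L θ γ : ℝ} (hL : 0 < L) (hθ : θ = L ^ (-γ)) (M : ℝ) (d' : ℕ) (p C δ : ℝ) :
    (∀ (k : ℕ) (Λ : Finset (Fin d → ℤ)) (U : pt9Bg.Cfg), EtaRateIneqSite d' p (stepKernel X L M k Λ) C δ γ U) ↔
      UnitStepIneq X C δ θ := by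
  subst hθ
  constructor
  · intro h k y y'
    have hy : y ∈ ({y, y'} : Finset (Fin d → ℤ)) := Finset.mem_insert_self y {y'}
    have hy' : y' ∈ ({y, y'} : Finset (Fin d → ℤ)) := Finset.mem_insert_of_mem (Finset.mem_singleton_self y')
    exact (etaRateIneqSite_window_iff hL M k {y, y'} d' p C δ γ ()).mp (h k {y, y'} ()) ⟨y, hy⟩ ⟨y', hy'⟩
  · intro h k Λ U
    exact (etaRateIneqSite_window_iff hL M k Λ d' p C δ γ U).mpr (fun y y' => h k y.1 y'.1)

/-- **RATE PAIRS PRODUCE THE SITE LAYER.**  A unit-lattice rate pair `RatePair X C δ C′ θ` with `θ = L^{−γ}` gives, for EVERY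
exponent pair `(d′, p)`, every `k`, every window and the (unique) configuration, `EtaRateIneqSite d′ p (stepKernel X L M k Λ) C′ δ γ U`
— constants `(C′, δ, γ)` uniform in `(k, Λ, M)`. [folklore] -/
theorem etaRateIneqSite_of_ratePair {C δ C' θ L γ : ℝ} (hR : RatePair X C δ C' θ) (hL : 0 < L) (hθ : θ = L ^ (-γ))
    (M : ℝ) (k : ℕ) (Λ : Finset (Fin d → ℤ)) (d' : ℕ) (p : ℝ) (U : pt9Bg.Cfg) :
    EtaRateIneqSite d' p (stepKernel X L M k Λ) C' δ γ U :=
  (forall_window_iff_unitStepIneq hL hθ M d' p C' δ).mpr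
    ((unitStepIneq_iff X C' δ θ).mpr (fun k => by simpa [mul_comm] using hR.rate k)) k Λ U

end Pointwise

/-! ## §3 The same in the block-majorant currency of `B11SectG.HasMaj` (the input format of `T4EtaRateDefectSite`) -/

section BlockMajorant

variable {X : ℕ → (Fin d → ℤ) → ℝ}

/-- THE Λ-COMPRESSED CONVOLUTION OPERATOR of a unit-lattice kernel `f`: `(convOp f Λ μ)(y) = Σ_{y′ ∈ Λ} f(y − y′) μ(y′)`.
[folklore] -/
def convOp (f : (Fin d → ℤ) → ℝ) (Λ : Finset (Fin d → ℤ)) : (↥Λ → ℝ) →ₗ[ℝ] (↥Λ → ℝ) where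
  toFun μ := fun y => ∑ y' : ↥Λ, f (y.1 - y'.1) * μ y'
  map_add' μ ν := by
    funext y
    simp only [Pi.add_apply, mul_add, Finset.sum_add_distrib]
  map_smul' a μ := by
    funext y
    simp only [Pi.smul_apply, smul_eq_mul, RingHom.id_apply, Finset.mul_sum]
    refine Finset.sum_congr rfl fun y' _ => by ring

/-- Unfolding of `convOp`. [folklore] -/
theorem convOp_apply (f : (Fin d → ℤ) → ℝ) (Λ : Finset (Fin d → ℤ)) (μ : ↥Λ → ℝ) (y : ↥Λ) :
    convOp f Λ μ y = ∑ y' : ↥Λ, f (y.1 - y'.1) * μ y' := rfl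

/-- The matrix entry of the compressed convolution operator is the kernel: `entry (convOp f Λ) y y′ = f(y − y′)`. [folklore] -/
@[simp] theorem entry_convOp (f : (Fin d → ℤ) → ℝ) (Λ : Finset (Fin d → ℤ)) (y y' : ↥Λ) :
    entry (convOp f Λ) y y' = f (y.1 - y'.1) := by
  rw [entry_apply, convOp_apply]
  rw [Finset.sum_eq_single y']
  · simp
  · intro z _ hz
    simp [Pi.single_eq_of_ne hz]
  · intro h
    exact absurd (Finset.mem_univ y') h

variable {L : ℝ}

/-- **THE (3.48) DICTIONARY on the window carrier**: between the (3.48)-normalised norms `srcNorm d′` → `obsNorm id p` of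
`T4EtaRateDefectSite` (all weights `= 1` at unit sites) a block majorant `K` of `convOp f Λ` IS the pointwise bound
`|f(y − y′)| ≤ K(y, y′)`. [cite: Balaban1985BackgroundPropagators, Thm 3.2 (3.48) p.398 (normalisation, shape)] -/
theorem hasMaj_convOp_iff (hL : 0 < L) (M : ℝ) (k : ℕ) (Λ : Finset (Fin d → ℤ)) (R : ℝ) (H : Prop) (d' : ℕ) (p : ℝ)
    (f : (Fin d → ℤ) → ℝ) (K : ↥Λ → ↥Λ → ℝ) :
    HasMaj (srcNorm (windowGeo d L M k Λ) R H hL.le (windowGeo_eta_pos hL M k Λ).le d')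
        (obsNorm (windowGeo d L M k Λ) R H hL.le (windowGeo_eta_pos hL M k Λ).le (fun y : (windowGeo d L M k Λ).Site => y) p)
        (convOp f Λ) K ↔
      ∀ y y' : ↥Λ, |f (y.1 - y'.1)| ≤ K y y' := by
  rw [hasMaj_site_iff (g₉ := windowGeo d L M k Λ) (R := R) (H := H)]
  refine forall_congr' fun y => forall_congr' fun y' => ?_
  rw [windowGeo_len hL.ne', windowGeo_len hL.ne', Real.one_rpow, Real.one_rpow, one_mul, mul_one, entry_convOp]

/-- **A RATE PAIR IS EXACTLY THE PRODUCER'S HYPOTHESIS.**  `RatePair X C δ C′ θ` with `θ = L^{−γ}` gives, on every window and for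
every `k`, the block majorant `C′·e^{−δ d(y,y′)}·rateWeight γ (y′)` of `convOp (step X k) Λ` between `srcNorm d′` and `obsNorm id p`
— literally the hypothesis `h` of `T4EtaRateDefectSite.etaRateIneqSite_of_hasMaj` (with `D U := convOp (step X k) Λ`, `ι = blk′ =
id`). [folklore] -/
theorem hasMaj_convOp_step_of_ratePair {C δ C' θ γ : ℝ} (hR : RatePair X C δ C' θ) (hL : 0 < L) (hθ : θ = L ^ (-γ))
    (M : ℝ) (k : ℕ) (Λ : Finset (Fin d → ℤ)) (R : ℝ) (H : Prop) (d' : ℕ) (p : ℝ) :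
    HasMaj (srcNorm (windowGeo d L M k Λ) R H hL.le (windowGeo_eta_pos hL M k Λ).le d')
      (obsNorm (windowGeo d L M k Λ) R H hL.le (windowGeo_eta_pos hL M k Λ).le (fun y : (windowGeo d L M k Λ).Site => y) p)
      (convOp (step X k) Λ)
      (fun y y' => C' * Real.exp (-(δ * (windowGeo d L M k Λ).dist y y')) *
        rateWeight (B9Thm34Ext.toB6 (windowGeo d L M k Λ) R H) γ y') := by
  rw [hasMaj_convOp_iff hL M k Λ R H d' p]
  intro y y'
  rw [rateWeight_windowGeo hL, ← hθ, windowGeo_dist, step_apply]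
  have h := hR.rate k (y.1 - y'.1)
  rw [step_apply, neg_mul] at h
  exact h.trans (le_of_eq (by ring))

/-- K2's defect site kernel of the operator family `U ↦ convOp (step X k) Λ`, read along the identity section, IS the
η-difference site kernel `stepKernel X L M k Λ`. [folklore] -/
theorem defectKernel_convOp (X : ℕ → (Fin d → ℤ) → ℝ) (L M : ℝ) (k : ℕ) (Λ : Finset (Fin d → ℤ)) :
    defectKernel (g₉ := windowGeo d L M k Λ) (fun y : (windowGeo d L M k Λ).Site => y)
        (fun _ : pt9Bg.Cfg => convOp (step X k) Λ) = stepKernel X L M k Λ := by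
  refine congrArg B9.SiteKernel.mk ?_
  funext U y y'
  rw [entry_convOp, step_apply]

/-- **THE TWO CURRENCIES AGREE**: the conclusion of `etaRateIneqSite_of_ratePair` re-obtained THROUGH K2's producer
`T4EtaRateDefectSite.etaRateIneqSite_of_hasMaj` fed with `hasMaj_convOp_step_of_ratePair`. [folklore] -/
theorem etaRateIneqSite_of_ratePair' {C δ C' θ γ : ℝ} (hR : RatePair X C δ C' θ) (hL : 0 < L) (hθ : θ = L ^ (-γ))
    (M : ℝ) (k : ℕ) (Λ : Finset (Fin d → ℤ)) (d' : ℕ) (p : ℝ) (U : pt9Bg.Cfg) :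
    EtaRateIneqSite d' p (stepKernel X L M k Λ) C' δ γ U := by
  rw [← defectKernel_convOp X L M k Λ]
  exact etaRateIneqSite_of_hasMaj (g₉ := windowGeo d L M k Λ) (R := 0) (H := True)
    (fun y : (windowGeo d L M k Λ).Site => y) (fun y => y) (fun _ => rfl) hL (windowGeo_eta_pos hL M k Λ)
    hR.rateConst_nonneg (fun _ : pt9Bg.Cfg => convOp (step X k) Λ) U
    (hasMaj_convOp_step_of_ratePair hR hL hθ M k Λ 0 True d' p)

end BlockMajorant

/-! ## §4 Packaging under the row's quantifier blocks: `NE2ZeroSite`, and the window family inhabits `NE2PlusSite` -/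

/-- **NE2⁰, site-kernel layer** (HYPOTHESIS SHAPE): the site-kernel inequality `EtaRateIneqSite d′ p` with uniform constants at
the TRIVIAL background `U ≡ 1` only — the site twin of `T4EtaRate.NE2ZeroOperator` / `T4EtaRateUnitWitness.NE2ZeroUnit`
(`A = 0`: the layer for which King's scalar estimates are the printed model; for Bałaban's objects NOT printed either).
[cite: King1986, Lemma 4.5 (4.38) p.674 (A = 0 model); Balaban1985BackgroundPropagators, Thm 3.2 (3.48) p.398 (majorant shape)] -/
def NE2ZeroSite {I : Type} (d' : ℕ) (p : ℝ) (pi : I → PairedInstance)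
    (Kd : ∀ i, B9.SiteKernel (pi i).gc (pi i).Bf) : Prop :=
  ∃ M₅ δ C γ : ℝ, 0 < M₅ ∧ 0 < δ ∧ 0 < C ∧ 0 < γ ∧
    ∀ i : I, M₅ ≤ (pi i).gf.M → EtaRateIneqSite d' p (Kd i) C δ γ (pi i).Bf.one

/-- Bookkeeping (kernel-checked): NE2⁺-site implies NE2⁰-site, given that the trivial configuration is (3.35)-regular for every
`α₀ > 0` — the site twin of `T4EtaRate.ne2Zero_of_ne2Plus`. [folklore] -/
theorem ne2ZeroSite_of_ne2PlusSite {I : Type} {d' : ℕ} {p c35 : ℝ} {pi : I → PairedInstance}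
    {Kd : ∀ i, B9.SiteKernel (pi i).gc (pi i).Bf}
    (hreg : ∀ (i : I) (α₀ : ℝ), 0 < α₀ → (pi i).Bf.Reg335 c35 α₀ (pi i).Bf.one)
    (h : NE2PlusSite d' p c35 pi Kd) : NE2ZeroSite d' p pi Kd := by
  obtain ⟨M₅, δ, a₀, C, γ, hM, hδ, ha, hC, hγ, H⟩ := h
  refine ⟨M₅, δ, C, γ, hM, hδ, hC, hγ, fun i hMi => ?_⟩
  have hMpos : 0 < (pi i).gf.M := lt_of_lt_of_le hM hMi
  have hα : 0 < a₀ / (pi i).gf.M := div_pos ha hMpos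
  have hMne : (pi i).gf.M ≠ 0 := hMpos.ne'
  have hMa : (pi i).gf.M * (a₀ / (pi i).gf.M) = a₀ := by field_simp
  exact H i hMi (a₀ / (pi i).gf.M) hα hMa.le _ (hreg i _ hα)

section Family

variable {X : ℕ → (Fin d → ℤ) → ℝ} {L : ℝ}

/-- **`NE2PlusSite` IS INHABITED by the window family of any rate pair** with `δ > 0`, `θ = L^{−γ}`, `γ > 0` (`L > 0`), for every
exponent pair `(d′, p)` and every geometric constant `c35`: constants `(M₅, δ, a₀, C, γ) = (1, δ, 1, max C′ 1, γ)`.  HONEST SCOPE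
(ii): the background quantifier ranges over `{U ≡ 1}` and (3.35) is trivial there — NE2⁰ CONTENT inside NE2⁺'s TYPE, not the
background-dependent estimate NE2⁺ (NOT PRINTED, not claimed); rate, decay and uniformity in `(k, Λ, M)` are genuine.
[cite: Balaban1985BackgroundPropagators, Thm 3.2 (3.48) p.398 + Thm 3.14 pp.426–427 (quantifier template)] [folklore] -/
theorem ne2PlusSite_of_ratePair {C δ C' θ γ : ℝ} (hR : RatePair X C δ C' θ) (hL : 0 < L) (hθ : θ = L ^ (-γ))
    (hδ : 0 < δ) (hγ : 0 < γ) (d' : ℕ) (p c35 : ℝ) :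
    NE2PlusSite d' p c35 (windowInstance d hL.ne') (stepKernels X hL.ne') := by
  refine ⟨1, δ, 1, max C' 1, γ, one_pos, hδ, one_pos, lt_max_of_lt_right one_pos, hγ,
    fun i _ α₀ _ _ U _ => ?_⟩
  exact etaRateIneqSite_mono_const (g := windowGeo d L i.M i.k i.Λ) hL.le (windowGeo_eta_pos hL i.M i.k i.Λ).le
    (le_max_left C' 1) (etaRateIneqSite_of_ratePair hR hL hθ i.M i.k i.Λ d' p U)

/-- **`NE2ZeroSite` HOLDS for the window family of any rate pair** with `δ > 0`, `θ = L^{−γ}`, `γ > 0` — hypothesis-free in the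
background (there is none but `U ≡ 1`). [folklore] -/
theorem ne2ZeroSite_of_ratePair {C δ C' θ γ : ℝ} (hR : RatePair X C δ C' θ) (hL : 0 < L) (hθ : θ = L ^ (-γ))
    (hδ : 0 < δ) (hγ : 0 < γ) (d' : ℕ) (p : ℝ) :
    NE2ZeroSite d' p (windowInstance d hL.ne') (stepKernels X hL.ne') :=
  ne2ZeroSite_of_ne2PlusSite (c35 := 0) (fun _ _ _ => trivial) (ne2PlusSite_of_ratePair hR hL hθ hδ hγ d' p 0)

/-- **A UNIT-LATTICE STEP INEQUALITY WITH POSITIVE CONSTANTS INHABITS `NE2PlusSite` on the window family** (`L > 0`, rate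
`θ = L^{−γ}`), for every exponent pair and geometric constant: constants `(M₅, δ, a₀, C, γ) = (1, δ, 1, C, γ)`; HONEST SCOPE (ii)
as above. [folklore] -/
theorem ne2PlusSite_of_unitStepIneq {C δ γ : ℝ} (hL : 0 < L) (hU : UnitStepIneq X C δ (L ^ (-γ))) (hC : 0 < C)
    (hδ : 0 < δ) (hγ : 0 < γ) (d' : ℕ) (p c35 : ℝ) :
    NE2PlusSite d' p c35 (windowInstance d hL.ne') (stepKernels X hL.ne') :=
  ⟨1, δ, 1, C, γ, one_pos, hδ, one_pos, hC, hγ, fun i _ _ _ _ U _ =>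
    (forall_window_iff_unitStepIneq (γ := γ) hL rfl i.M d' p C δ).mpr hU i.k i.Λ U⟩

/-- **READOUT — THE PACKAGED TYPE IS NOT VACUOUS (v1.2, answering XREAD C-pv05g13-12, V1).**  On the window family (indexed by
`(k, Λ, M)`, ALL `M ≥ 1`) a proof of `NE2ZeroSite d′ p` RETURNS a unit-lattice step inequality with positive constants and rate
`θ = L^{−γ}`: the index `M := max M₅ 1` discharges the guard `M₅ ≤ M`, and `forall_window_iff_unitStepIneq` reads the inequality
off all windows.  (Under v1.1's `M := 1` carriers, `M₅ := 2` voided the guard at every index and the type was inhabited for EVERY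
kernel family.) [folklore] -/
theorem exists_unitStepIneq_of_ne2ZeroSite (hL : 0 < L) {d' : ℕ} {p : ℝ}
    (h : NE2ZeroSite d' p (windowInstance d hL.ne') (stepKernels X hL.ne')) :
    ∃ C δ γ : ℝ, 0 < C ∧ 0 < δ ∧ 0 < γ ∧ UnitStepIneq X C δ (L ^ (-γ)) := by
  obtain ⟨M₅, δ, C, γ, _, hδ, hC, hγ, H⟩ := h
  exact ⟨C, δ, γ, hC, hδ, hγ, (forall_window_iff_unitStepIneq (γ := γ) hL rfl (max M₅ 1) d' p C δ).mp
    fun k Λ U => H ⟨k, Λ, max M₅ 1, le_max_right M₅ 1⟩ (le_max_left M₅ 1)⟩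

/-- **`NE2ZeroSite` ON THE WINDOW FAMILY ⟺ A `UnitStepIneq` WITH POSITIVE CONSTANTS** (rate `θ = L^{−γ}`, `L > 0`): restricted
to the `U ≡ 1` window family of a unit-lattice family `X`, the packaged site-layer type IS the geometry-free η-rate shape of
`T4RateAlgebra` — neither vacuous nor more (v1.2). [folklore] -/
theorem ne2ZeroSite_window_iff (hL : 0 < L) (d' : ℕ) (p : ℝ) :
    NE2ZeroSite d' p (windowInstance d hL.ne') (stepKernels X hL.ne') ↔
      ∃ C δ γ : ℝ, 0 < C ∧ 0 < δ ∧ 0 < γ ∧ UnitStepIneq X C δ (L ^ (-γ)) :=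
  ⟨exists_unitStepIneq_of_ne2ZeroSite hL, fun ⟨_, _, _, hC, hδ, hγ, hU⟩ =>
    ne2ZeroSite_of_ne2PlusSite (c35 := 0) (fun _ _ _ => trivial) (ne2PlusSite_of_unitStepIneq hL hU hC hδ hγ d' p 0)⟩

/-- **`NE2PlusSite` ON THE WINDOW FAMILY ⟺ THE SAME `UnitStepIneq`** (every geometric constant `c35`; HONEST SCOPE (ii): at
`U ≡ 1` the (3.35) side conditions are trivially met, so NE2⁺'s TYPE on this family has exactly NE2⁰'s content) (v1.2). [folklore] -/
theorem ne2PlusSite_window_iff (hL : 0 < L) (d' : ℕ) (p c35 : ℝ) :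
    NE2PlusSite d' p c35 (windowInstance d hL.ne') (stepKernels X hL.ne') ↔
      ∃ C δ γ : ℝ, 0 < C ∧ 0 < δ ∧ 0 < γ ∧ UnitStepIneq X C δ (L ^ (-γ)) :=
  ⟨fun h => exists_unitStepIneq_of_ne2ZeroSite hL (ne2ZeroSite_of_ne2PlusSite (fun _ _ _ => trivial) h),
    fun ⟨_, _, _, hC, hδ, hγ, hU⟩ => ne2PlusSite_of_unitStepIneq hL hU hC hδ hγ d' p c35⟩

/-- **A SEPARATING FAMILY (v1.2): the packaged type is FALSE for the rate-less family `X_k ≡ 2^k`** (`L = 2`, every `d` and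
exponent pair) — by the readout a proof would give `2^k = |2^{k+1} − 2^k| ≤ C·(2^{−γ})^k ≤ C` at `y = y′` for every `k`.
[folklore] -/
theorem not_ne2ZeroSite_pow_two (d d' : ℕ) (p : ℝ) :
    ¬ NE2ZeroSite d' p (windowInstance d (L := (2 : ℝ)) two_ne_zero)
        (stepKernels (fun (k : ℕ) (_ : Fin d → ℤ) => (2 : ℝ) ^ k) two_ne_zero) := by
  intro h
  obtain ⟨C, δ, γ, hC, _, hγ, hU⟩ := exists_unitStepIneq_of_ne2ZeroSite two_pos h
  obtain ⟨k, hk⟩ := pow_unbounded_of_one_lt C (one_lt_two : (1 : ℝ) < 2)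
  have hθ1 : (2 : ℝ) ^ (-γ) ≤ 1 := Real.rpow_le_one_of_one_le_of_nonpos one_le_two (neg_nonpos.mpr hγ.le)
  have hθ0 : 0 ≤ (2 : ℝ) ^ (-γ) := Real.rpow_nonneg zero_le_two _
  have h0 := hU k 0 0
  have hl : l1 ((0 : Fin d → ℤ) - 0) = 0 := by simp [l1]
  rw [hl, mul_zero, neg_zero, Real.exp_zero, mul_one] at h0
  have h2 : |(2 : ℝ) ^ (k + 1) - 2 ^ k| = 2 ^ k := by
    rw [pow_succ, show (2 : ℝ) ^ k * 2 - 2 ^ k = 2 ^ k by ring]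
    exact abs_of_nonneg (pow_nonneg zero_le_two k)
  rw [h2] at h0
  have h3 : C * ((2 : ℝ) ^ (-γ)) ^ k ≤ C := by
    have := mul_le_mul_of_nonneg_left (pow_le_one₀ hθ0 hθ1 (n := k)) hC.le
    rwa [mul_one] at this
  exact absurd (h0.trans h3) (not_le.mpr hk)

/-- … hence `NE2PlusSite` is FALSE for that family too (every `c35`). [folklore] -/
theorem not_ne2PlusSite_pow_two (d d' : ℕ) (p c35 : ℝ) :
    ¬ NE2PlusSite d' p c35 (windowInstance d (L := (2 : ℝ)) two_ne_zero)
        (stepKernels (fun (k : ℕ) (_ : Fin d → ℤ) => (2 : ℝ) ^ k) two_ne_zero) :=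
  fun h => not_ne2ZeroSite_pow_two d d' p (ne2ZeroSite_of_ne2PlusSite (fun _ _ _ => trivial) h)

end Family

/-! ## §5 The first non-toy inhabitant, BY NAME: the (1.66)-layer entry kernels of `T4GaugeActionRatePair` -/

section Layer166

variable {d : ℕ}

/-- `θ = L⁻¹` is `L^{−γ}` with `γ = 1`. [folklore] -/
theorem inv_eq_rpow_neg_one (L : ℝ) : L⁻¹ = L ^ (-(1 : ℝ)) := (Real.rpow_neg_one L).symm

/-- **THE (1.66) LAYER INHABITS THE TYPED SITE LAYER** (every `L ≥ 1`, `μ ≠ ν`, `a`, `b`, `k`, window, exponent pair, at `U ≡ 1`):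
`EtaRateIneqSite d′ p (stepKernel (kerFamily L μ ν a b) L k Λ) (8·CWs(d+1)) (δ₁₆₆ d) 1 U` — i.e.
`|Re K^{(L^{k+1})}_{ab}(y−y′) − Re K^{(L^k)}_{ab}(y−y′)| ≤ 8·CWs·e^{−δ₁₆₆|y−y′|₁}·L^{−k}` dressed in the (3.48) format, from
`T4GaugeActionRatePair.ratePair_kerFamily` BY NAME. [cite: Balaban1984PropagatorsI, (1.66) p.29 (object)] [folklore] -/
theorem etaRateIneqSite_kerFamily166 (L : ℕ) [NeZero L] {μ ν : Fin (d + 1)} (hμν : μ ≠ ν) (a b : Fin (d + 1)) (M : ℝ) (k : ℕ)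
    (Λ : Finset (Fin (d + 1) → ℤ)) (d' : ℕ) (p : ℝ) (U : pt9Bg.Cfg) :
    EtaRateIneqSite d' p (stepKernel (kerFamily (d := d) L μ ν a b) (L : ℝ) M k Λ) (8 * CWs (d + 1)) (delta166 d) 1 U :=
  etaRateIneqSite_of_ratePair (ratePair_kerFamily L hμν a b)
    (by exact_mod_cast Nat.pos_of_ne_zero (NeZero.ne L)) (inv_eq_rpow_neg_one (L : ℝ)) M k Λ d' p U

/-- Consistency with the producing module's own T4 reading: the typed site layer on all windows of the (1.66) family IS its
`UnitStepIneq` (`T4GaugeActionRatePair.unitStepIneq_kerFamily`), by `forall_window_iff_unitStepIneq`. [folklore] -/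
theorem unitStepIneq_kerFamily166_iff (L : ℕ) [NeZero L] (μ ν a b : Fin (d + 1)) (M : ℝ) (d' : ℕ) (p C δ : ℝ) :
    (∀ (k : ℕ) (Λ : Finset (Fin (d + 1) → ℤ)) (U : pt9Bg.Cfg),
        EtaRateIneqSite d' p (stepKernel (kerFamily (d := d) L μ ν a b) (L : ℝ) M k Λ) C δ 1 U) ↔
      UnitStepIneq (kerFamily (d := d) L μ ν a b) C δ ((L : ℝ)⁻¹) :=
  forall_window_iff_unitStepIneq (by exact_mod_cast Nat.pos_of_ne_zero (NeZero.ne L)) (inv_eq_rpow_neg_one (L : ℝ)) M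
    d' p C δ

/-- **`NE2PlusSite` IS INHABITED BY ONE OF BAŁABAN'S OWN `U = 1` OBJECTS**: the window family of the (1.66)-layer entry kernels
(every `L ≥ 1`, `μ ≠ ν`; `γ = 1`, `δ = δ₁₆₆(d) > 0`, `C = max (8·CWs(d+1)) 1`; the rate `θ = L⁻¹` is `< 1` iff `L ≥ 2`,
`T4GaugeActionRatePair.theta_lt_one` — the shape itself records `γ`, not `θ`), for every exponent pair and geometric constant.
HONEST SCOPE (ii) as in `ne2PlusSite_of_ratePair`: NE2⁰ content inside NE2⁺'s type; NOT NE2⁺. [cite: Balaban1984PropagatorsI, (1.66) p.29 (object); Balaban1985BackgroundPropagators, Thm 3.14 pp.426–427 (quantifier template)] [folklore] -/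
theorem ne2PlusSite_kerFamily166 (L : ℕ) [NeZero L] {μ ν : Fin (d + 1)} (hμν : μ ≠ ν) (a b : Fin (d + 1))
    (d' : ℕ) (p c35 : ℝ) :
    NE2PlusSite d' p c35
      (windowInstance (d + 1) (L := (L : ℝ)) (by exact_mod_cast NeZero.ne L))
      (stepKernels (kerFamily (d := d) L μ ν a b) (by exact_mod_cast NeZero.ne L)) :=
  ne2PlusSite_of_ratePair (ratePair_kerFamily L hμν a b) (by exact_mod_cast Nat.pos_of_ne_zero (NeZero.ne L))
    (inv_eq_rpow_neg_one (L : ℝ)) (delta166_pos d) one_pos d' p c35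

/-- **`NE2ZeroSite` IS A THEOREM for the (1.66) layer** (every `L ≥ 1`, `μ ≠ ν`; rate `θ = L⁻¹ < 1` iff `L ≥ 2`): the `A = 0`
site-layer shape holds for the window family of `Re K^{(L^k)}_{ab}` with `γ = 1`, `δ = δ₁₆₆(d)`, hypothesis-free. [cite: Balaban1984PropagatorsI, (1.66) p.29 (object); King1986, Lemma 4.5 (4.38) p.674 (A = 0 sibling, shape)] [folklore] -/
theorem ne2ZeroSite_kerFamily166 (L : ℕ) [NeZero L] {μ ν : Fin (d + 1)} (hμν : μ ≠ ν) (a b : Fin (d + 1))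
    (d' : ℕ) (p : ℝ) :
    NE2ZeroSite d' p
      (windowInstance (d + 1) (L := (L : ℝ)) (by exact_mod_cast NeZero.ne L))
      (stepKernels (kerFamily (d := d) L μ ν a b) (by exact_mod_cast NeZero.ne L)) :=
  ne2ZeroSite_of_ratePair (ratePair_kerFamily L hμν a b) (by exact_mod_cast Nat.pos_of_ne_zero (NeZero.ne L))
    (inv_eq_rpow_neg_one (L : ℝ)) (delta166_pos d) one_pos d' p

/-- `θ = L⁻²` is `L^{−γ}` with `γ = 2` (`L ≥ 0`). [folklore] -/
theorem inv_sq_eq_rpow_neg_two {L : ℝ} (hL : 0 ≤ L) : (L ^ 2)⁻¹ = L ^ (-(2 : ℝ)) := by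
  rw [Real.rpow_neg hL, Real.rpow_two]

/-- **THE (1.66) LAYER AT KING'S FULL EXPONENT `γ = 2`** inhabits the typed site layer (every `L ≥ 1`, `μ ≠ ν`, `k`, window,
exponent pair, `U ≡ 1`): constant `8·C166(d+1)`, decay rate `κ₁₆₆(d+1)/(d+1)`, rate exponent `2` — from
`T4Rate166StripDirect.ratePair_kerFamily2` (seat t4-ne2-p2, `θ = L⁻²`) BY NAME. [cite: Balaban1984PropagatorsI, (1.66) p.29 (object); King1986, Prop. 3.9 (3.73) p.665 (the exponent)] [folklore] -/
theorem etaRateIneqSite_kerFamily166_king (L : ℕ) [NeZero L] {μ ν : Fin (d + 1)} (hμν : μ ≠ ν) (a b : Fin (d + 1))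
    (M : ℝ) (k : ℕ) (Λ : Finset (Fin (d + 1) → ℤ)) (d' : ℕ) (p : ℝ) (U : pt9Bg.Cfg) :
    EtaRateIneqSite d' p (stepKernel (kerFamily (d := d) L μ ν a b) (L : ℝ) M k Λ) (8 * C166 (d + 1))
      (kappa166 (d + 1) / ((d : ℝ) + 1)) 2 U :=
  etaRateIneqSite_of_ratePair (ratePair_kerFamily2 L hμν a b)
    (by exact_mod_cast Nat.pos_of_ne_zero (NeZero.ne L)) (inv_sq_eq_rpow_neg_two (Nat.cast_nonneg L)) M k Λ d' p U

/-- … and its window family inhabits `NE2PlusSite` with rate exponent `γ = 2` (every `L ≥ 1`, `μ ≠ ν`; HONEST SCOPE (ii):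
NE2⁰ content inside NE2⁺'s type). [cite: Balaban1984PropagatorsI, (1.66) p.29 (object); Balaban1985BackgroundPropagators, Thm 3.14 pp.426–427 (quantifier template)] [folklore] -/
theorem ne2PlusSite_kerFamily166_king (L : ℕ) [NeZero L] {μ ν : Fin (d + 1)} (hμν : μ ≠ ν) (a b : Fin (d + 1))
    (d' : ℕ) (p c35 : ℝ) :
    NE2PlusSite d' p c35
      (windowInstance (d + 1) (L := (L : ℝ)) (by exact_mod_cast NeZero.ne L))
      (stepKernels (kerFamily (d := d) L μ ν a b) (by exact_mod_cast NeZero.ne L)) :=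
  ne2PlusSite_of_ratePair (ratePair_kerFamily2 L hμν a b) (by exact_mod_cast Nat.pos_of_ne_zero (NeZero.ne L))
    (inv_sq_eq_rpow_neg_two (Nat.cast_nonneg L)) (div_pos (kappa166_pos (d + 1)) (by positivity)) two_pos d' p c35

end Layer166

/-! ### Smoke test on the model rate pair of `T4RateAlgebra.Witness` (`C′ = θ = ½ = 2^{−1}`, `δ = 1`, `L = 2`, `γ = 1`) -/

/-- The model family `X_k(x) = (1 + 2^{−k})e^{−|x|₁}` of `T4RateAlgebra.Witness` inhabits the typed site layer on every window
(`L = 2`, `γ = 1`, constant `½`, decay rate `1`). [folklore] -/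
example (d : ℕ) (M : ℝ) (k : ℕ) (Λ : Finset (Fin d → ℤ)) (d' : ℕ) (p : ℝ) (U : pt9Bg.Cfg) :
    EtaRateIneqSite d' p (stepKernel (T4RateAlgebra.Witness.X d) 2 M k Λ) (1 / 2) 1 1 U :=
  etaRateIneqSite_of_ratePair (T4RateAlgebra.Witness.ratePair d) two_pos
    (by rw [← inv_eq_rpow_neg_one]; norm_num) M k Λ d' p U

/-- … and its window family inhabits `NE2PlusSite` (any exponent pair, any `c35`). [folklore] -/
example (d d' : ℕ) (p c35 : ℝ) :
    NE2PlusSite d' p c35 (windowInstance d (L := (2 : ℝ)) two_ne_zero)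
      (stepKernels (T4RateAlgebra.Witness.X d) two_ne_zero) :=
  ne2PlusSite_of_ratePair (T4RateAlgebra.Witness.ratePair d) two_pos (by rw [← inv_eq_rpow_neg_one]; norm_num)
    one_pos one_pos d' p c35

/-- … and (v1.2 readout) its packaged `NE2ZeroSite` RETURNS a unit-lattice step inequality with rate `2^{−γ}`, `γ > 0`. [folklore] -/
example (d d' : ℕ) (p : ℝ) :
    ∃ C δ γ : ℝ, 0 < C ∧ 0 < δ ∧ 0 < γ ∧ UnitStepIneq (T4RateAlgebra.Witness.X d) C δ ((2 : ℝ) ^ (-γ)) :=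
  exists_unitStepIneq_of_ne2ZeroSite two_pos (ne2ZeroSite_of_ratePair (T4RateAlgebra.Witness.ratePair d) two_pos
    (by rw [← inv_eq_rpow_neg_one]; norm_num) one_pos one_pos d' p)

end

end Literature.MathematicalPhysics.QuantumFieldTheory.Balaban1983to89.T4EtaRateSiteOfRatePair
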